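import Summits.QuantumFields.YangMills.Theorems.UnitScaleTiltProp7HolRatioPerStep
import HarnessLib

/-!
# Route `UnitScaleTilt`, crux K1 child «MinimiserStabilityRegPr» (stmt-QuantumFields-19200), registered stub `stub_prop7From14` (leaf V3 «Prop 7 from a
# background (14)») — THE (0.4) AVERAGE OF RECORD AT A SMALL-FIELD BACKGROUND, LINEARISED WITH THE TRUE DERIVATIVE OF `exp`-mean-`log`, WITH A
# REMAINDER QUADRATIC IN THE `ℓ¹` MASSES OF `Y` ALONG THE (0.4) WALKS:
# `‖Ū(c)Ū₀(c)* − 1 − (D eml(W₀)[Λ·W₀]·κ₀* + κ₀·Y_{U₀}(segment)·κ₀*)‖ ≤ 260·m²` whenever every walk mass `Σ_{s∈walk}‖Y_{b(s)}‖ ≤ m ≤ 1/72`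

Cell `ym3-torus` ∕ fleet seat `ym-ust-19200-p1` (gen 4).  WHERE THIS SITS.  `BlockAveragingEMLLinearisedBackground.norm_avgFun_ratio_sub_one_sub_covLinAvg_le`
(p484812) linearises the (0.4) averaging `Ū = avgFun expMeanLogSU U` at a background `U₀` as `covLinAvg U₀ Y` with remainder `400ℓδ(ℓδ + α)`: (i) quadratic in the
SUP bound `δ` of `Y` times the walk length `ℓ`, and (ii) with a term LINEAR in `Y` of size `α·ℓδ` (`α` the size of the background's loop variables),
because `covLinAvg` replaces the derivative `D eml(W₀)` of the analytic mean at the background's loop tuple `W₀` by the plain mean and drops the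
conjugation by the background correction factor `κ₀`.  The `ℓ²` route to [Balaban1985Variational] Prop. 7 (CARD-19200-V3-g4, D1c) needs the TRUE
derivative (so that the Euler–Lagrange equation pairs with it exactly) and a remainder QUADRATIC IN THE `ℓ¹` MASS OF `Y` ALONG EACH WALK (then `≤ ℓ·Σ‖Y‖²`
along the walk by Cauchy–Schwarz, summable over the block against `Σ‖Y‖²`).  This file proves exactly that, one (0.4) step, any small-field background:
the linear operator is `Y ↦ D eml(W₀)[i ↦ Y_{U₀}(loop_i)·W₀,i]·κ₀* + κ₀·Y_{U₀}(segment)·κ₀*` (no new definition: `fderiv ℂ eml` of the tree), the remainder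
`≤ 260·m²` with `m` any common bound of the walk masses (hypotheses `hmL`, `hmS`), from `Prop7HolRatioPerStep` (per-step holonomy ratio, this seat) and the
analytic-mean engine (`IsAnalyticMean.norm_sub_sub_fderiv_le`, `norm_fderiv_eml_apply_le`, `norm_eml_add_sub_eml_le`).

WHAT IS PROVED HERE (sorry-free, no definition): **`norm_avgFun_ratio_sub_one_sub_trueLin_le`** (the title).  HONEST SCOPE: one averaging step; the
`k`-fold composition, the transpose/multiplier structure of this linear operator, and the identification with print's `Q(U₀)` of [Balaban1985Averaging]
(124) are not here.  Nothing of Bałaban's is asserted.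

References: T. Bałaban, CMP 98 (1985) 17–51 [Balaban1985Averaging] (Prop. 3 (122)–(125) p.36); CMP 109 (1987) 249–301 [Balaban1987RG1] ((0.4), (0.8));
CMP 102 (1985) 277–309 [Balaban1985Variational] ((44) p.285).
-/

noncomputable section

open scoped BigOperators Matrix.Norms.L2Operator

namespace Summit.QuantumFields.YangMills.Theorems.Prop7HolRatioPerStep

open Literature.MathematicalPhysics.QuantumFieldTheory.Balaban1983to89
open T4Continuum BlockAveraging AveragingRT ExpMeanLog LatticeWordStokes B7TransferAnalyticMean BlockAveragingEMLAnalyticMean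
open BlockAveragingEMLLinearised BlockAveragingEMLLinearisedBackground

variable {n : Type*} [Fintype n] [DecidableEq n] [Nonempty n] {P : Params} {j : ℕ}

/-- The sup norm of a finite family is at most `B` when every member is. [folklore] -/
theorem pi_norm_le_of_forall {ι : Type*} [Fintype ι] {𝔸 : Type*} [SeminormedAddCommGroup 𝔸] {f : ι → 𝔸} {B : ℝ} (hB : 0 ≤ B)
    (h : ∀ i, ‖f i‖ ≤ B) : ‖f‖ ≤ B :=
  (pi_norm_le_iff_of_nonneg hB).2 h

/-- `Π_{s∈Γ}(1 + ‖Y_s‖) − 1 ≤ 2·Σ_{s∈Γ}‖Y_s‖` when the mass `Σ_{s∈Γ}‖Y_s‖ ≤ 1` (`e^x − 1 ≤ x + x²`). [folklore] -/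
theorem list_prod_one_add_sub_one_le_two_mul {ι : Type*} (a : ι → ℝ) (ha : ∀ x, 0 ≤ a x) (l : List ι) (hs : (l.map a).sum ≤ 1) :
    (l.map fun x => 1 + a x).prod - 1 ≤ 2 * (l.map a).sum := by
  have h1 := list_prod_one_add_le_exp_sum a ha l
  have hS0 : 0 ≤ (l.map a).sum := List.sum_nonneg fun y hy => by obtain ⟨z, _, rfl⟩ := List.mem_map.mp hy; exact ha z
  have h2 : |Real.exp (l.map a).sum - 1 - (l.map a).sum| ≤ (l.map a).sum ^ 2 :=
    Real.abs_exp_sub_one_sub_id_le (by rw [abs_of_nonneg hS0]; exact hs)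
  have h3 := le_abs_self (Real.exp (l.map a).sum - 1 - (l.map a).sum)
  nlinarith

set_option maxHeartbeats 400000 in
/-- **THE (0.4) AVERAGE AT A SMALL-FIELD BACKGROUND, LINEARISED WITH THE TRUE DERIVATIVE, REMAINDER QUADRATIC IN THE WALK MASSES**: background `U₀`
with (0.4) loop variables at `c` within `α ≤ 1/24` of `1`; `Y = pertVar U₀ U`; every (0.4) loop walk at `c` and the straight segment carry `ℓ¹` mass
`Σ_{s}‖Y_{b(s)}‖ ≤ m` with `72m ≤ 1`; `3m + α < δ_N`.  Then, with `W₀,i` the background loop variables, `κ₀` the background correction factor `eml W₀`,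
`Λ_i = Y_{U₀}(loop_i)`, `Λ_S = Y_{U₀}(segment)`:
`‖Ū(c)·Ū₀(c)* − 1 − (D eml(W₀)[i ↦ Λ_i W₀,i]·κ₀* + κ₀ Λ_S κ₀*)‖ ≤ 260·m²`. [cite: Balaban1985Averaging, Prop. 3 (122)-(124) p.36] -/
theorem norm_avgFun_ratio_sub_one_sub_trueLin_le (U₀ U : GaugeField P j (Matrix.specialUnitaryGroup n ℂ)) (c : PBond P (j + 1)) {m α : ℝ}
    (hmL : ∀ i : Idx P, ((walk (emb c.src) (loopWord P.L c.dir (off i.1) i.2.1 i.2.2)).map fun s => ‖pertVar U₀ U s.bond‖).sum ≤ m)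
    (hmS : ((walk (emb c.src) (List.replicate P.L (c.dir, true))).map fun s => ‖pertVar U₀ U s.bond‖).sum ≤ m)
    (hm72 : 72 * m ≤ 1) (hα : ∀ i, dist1 (loopHol U₀ c i) ≤ α) (hα24 : α ≤ 1 / 24) (hN : 3 * m + α < deltaSU n) :
    ‖((avgFun (expMeanLogSU (n := n)) U c : Matrix.specialUnitaryGroup n ℂ) : Matrix n n ℂ) *
          star ((avgFun (expMeanLogSU (n := n)) U₀ c : Matrix.specialUnitaryGroup n ℂ) : Matrix n n ℂ) - 1 -
        (fderiv ℂ (eml : (Idx P → Matrix n n ℂ) → Matrix n n ℂ) (fun i => ((loopHol U₀ c i : Matrix.specialUnitaryGroup n ℂ) : Matrix n n ℂ))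
            (fun i => covWalkSum U₀ (pertVar U₀ U) (walk (emb c.src) (loopWord P.L c.dir (off i.1) i.2.1 i.2.2))
              * ((loopHol U₀ c i : Matrix.specialUnitaryGroup n ℂ) : Matrix n n ℂ))
            * star ((corr (expMeanLogSU (n := n)) U₀ c : Matrix.specialUnitaryGroup n ℂ) : Matrix n n ℂ)
          + ((corr (expMeanLogSU (n := n)) U₀ c : Matrix.specialUnitaryGroup n ℂ) : Matrix n n ℂ)
            * covWalkSum U₀ (pertVar U₀ U) (walk (emb c.src) (List.replicate P.L (c.dir, true)))
            * star ((corr (expMeanLogSU (n := n)) U₀ c : Matrix.specialUnitaryGroup n ℂ) : Matrix n n ℂ))‖ ≤ 260 * m ^ 2 := by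
  -- letters
  have hm0 : 0 ≤ m := (List.sum_nonneg fun y hy => by obtain ⟨z, _, rfl⟩ := List.mem_map.mp hy; exact norm_nonneg _).trans hmS
  have hm1 : m ≤ 1 := by linarith
  have hα0 : 0 ≤ α := (GaugeGroup.dist1_nonneg _).trans (hα (Classical.arbitrary _))
  set Y : PBond P j → Matrix n n ℂ := pertVar U₀ U with hYdef
  set W : Idx P → Matrix n n ℂ := fun i => ((loopHol U c i : Matrix.specialUnitaryGroup n ℂ) : Matrix n n ℂ) with hW
  set W₀ : Idx P → Matrix n n ℂ := fun i => ((loopHol U₀ c i : Matrix.specialUnitaryGroup n ℂ) : Matrix n n ℂ) with hW₀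
  set Λ : Idx P → Matrix n n ℂ := fun i => covWalkSum U₀ Y (walk (emb c.src) (loopWord P.L c.dir (off i.1) i.2.1 i.2.2)) with hΛ
  -- the loop ratios, per loop, from the per-step bounds
  have hratio : ∀ i, ‖W i * star (W₀ i) - 1‖ ≤ 2 * m ∧ ‖W i * star (W₀ i) - 1 - Λ i‖ ≤ 2 * m ^ 2 := by
    intro i
    have h := norm_holRatio_bounds_perStep U₀ U (walk (emb c.src) (loopWord P.L c.dir (off i.1) i.2.1 i.2.2))
    have hs1 : ((walk (emb c.src) (loopWord P.L c.dir (off i.1) i.2.1 i.2.2)).map fun s => ‖pertVar U₀ U s.bond‖).sum ≤ 1 := (hmL i).trans hm1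
    have h2 := norm_holRatio_sub_covWalkSum_le_two_mul_sq U₀ U (walk (emb c.src) (loopWord P.L c.dir (off i.1) i.2.1 i.2.2)) hs1
    have h3 := list_prod_one_add_sub_one_le_two_mul (fun s : LStep P j => ‖pertVar U₀ U s.bond‖) (fun _ => norm_nonneg _) _ hs1
    have hmi0 : 0 ≤ ((walk (emb c.src) (loopWord P.L c.dir (off i.1) i.2.1 i.2.2)).map fun s => ‖pertVar U₀ U s.bond‖).sum :=
      List.sum_nonneg fun y hy => by obtain ⟨z, _, rfl⟩ := List.mem_map.mp hy; exact norm_nonneg _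
    refine ⟨h.1.trans (h3.trans (by linarith [hmL i])), h2.trans ?_⟩
    have := pow_le_pow_left₀ hmi0 (hmL i) 2
    linarith
  -- unitarity of the background loop variables and their size
  have hW₀u : ∀ i, star (W₀ i) * W₀ i = 1 := fun i => coe_star_mul_self _
  have hW₀1 : ∀ i, ‖W₀ i - 1‖ ≤ α := fun i => by rw [hW₀, ← FederbushMean.dist1_SU_eq]; exact hα i
  have hW₀n : ∀ i, ‖W₀ i‖ = 1 := fun i => norm_coe_eq_one _
  -- the increments `V = W − W₀` and their linear parts `Λ·W₀`
  set V : Idx P → Matrix n n ℂ := W - W₀ with hV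
  set Vl : Idx P → Matrix n n ℂ := fun i => Λ i * W₀ i with hVl
  have hVi : ∀ i, V i = (W i * star (W₀ i) - 1) * W₀ i := fun i => by
    simp only [hV, Pi.sub_apply]; rw [sub_mul, mul_assoc, hW₀u, mul_one, one_mul]
  have hVn : ∀ i, ‖V i‖ ≤ 2 * m := fun i => by
    rw [hVi]; exact (norm_mul_le _ _).trans (by rw [hW₀n, mul_one]; exact (hratio i).1)
  have hVVl : ∀ i, ‖V i - Vl i‖ ≤ 2 * m ^ 2 := fun i => by
    have e : V i - Vl i = (W i * star (W₀ i) - 1 - Λ i) * W₀ i := by rw [hVi, hVl]; noncomm_ring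
    rw [e]; exact (norm_mul_le _ _).trans (by rw [hW₀n, mul_one]; exact (hratio i).2)
  -- the guards: both families are small
  have hsmall₀ : ∀ i, dist1 (loopHol U₀ c i) < deltaSU n := fun i => (hα i).trans_lt (by linarith)
  have hsmall : ∀ i, dist1 (loopHol U c i) < deltaSU n := by
    intro i
    rw [FederbushMean.dist1_SU_eq]
    have e : ((loopHol U c i : Matrix.specialUnitaryGroup n ℂ) : Matrix n n ℂ) - 1 = V i + (W₀ i - 1) := by
      simp only [hV, Pi.sub_apply, hW]; abel
    rw [e]
    calc ‖V i + (W₀ i - 1)‖ ≤ 2 * m + α := (norm_add_le _ _).trans (add_le_add (hVn i) (hW₀1 i))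
      _ < deltaSU n := by linarith
  -- the correction factors as `eml`
  set κ : Matrix n n ℂ := ((corr (expMeanLogSU (n := n)) U c : Matrix.specialUnitaryGroup n ℂ) : Matrix n n ℂ) with hκ
  set κ₀ : Matrix n n ℂ := ((corr (expMeanLogSU (n := n)) U₀ c : Matrix.specialUnitaryGroup n ℂ) : Matrix n n ℂ) with hκ₀
  have hsmallS : Small (expMeanLogSU (n := n)) U c := hsmall
  have hsmallS₀ : Small (expMeanLogSU (n := n)) U₀ c := hsmall₀
  have hκeml : κ = eml (W₀ + V) := by
    have h1 : κ = eml W := by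
      rw [hκ]; unfold corr; rw [if_pos hsmallS, BlockAveragingEMLProp2.coe_avg_eq_eml _ hsmall]
    rw [h1, hV, add_sub_cancel]
  have hκ₀eml : κ₀ = eml W₀ := by
    rw [hκ₀]; unfold corr; rw [if_pos hsmallS₀, BlockAveragingEMLProp2.coe_avg_eq_eml _ hsmall₀]
  -- sup norms of the families
  have hW₀sup : ‖W₀ - 1‖ ≤ 1 / 24 := pi_norm_le_of_forall (by norm_num) fun i => (hW₀1 i).trans hα24
  have hW₀sup6 : ‖W₀ - 1‖ ≤ 1 / 6 := hW₀sup.trans (by norm_num)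
  have hVsup : ‖V‖ ≤ 2 * m := pi_norm_le_of_forall (by positivity) fun i => hVn i
  have hVsup' : ‖V‖ ≤ 1 / 24 := hVsup.trans (by linarith)
  have hVVlsup : ‖V - Vl‖ ≤ 2 * m ^ 2 := pi_norm_le_of_forall (by positivity) fun i => by simpa only [Pi.sub_apply] using hVVl i
  -- `H = κ − κ₀` against the true derivative `D = D eml(W₀)[Vl]`
  set H : Matrix n n ℂ := κ - κ₀ with hH
  set D : Matrix n n ℂ := fderiv ℂ (eml : (Idx P → Matrix n n ℂ) → Matrix n n ℂ) W₀ Vl with hD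
  have hE₁ : ‖eml (W₀ + V) - eml W₀ - fderiv ℂ (eml : (Idx P → Matrix n n ℂ) → Matrix n n ℂ) W₀ V‖ ≤ 190 * m ^ 2 := by
    have hA := isAnalyticMean_eml (ι := Idx P) (𝔸 := Matrix n n ℂ)
    have hUball : W₀ ∈ Metric.ball (1 : Idx P → Matrix n n ℂ) (1 / 3) := by
      rw [Metric.mem_ball, dist_eq_norm]; linarith
    have hV4 : 4 * ‖V‖ ≤ 1 / 3 - ‖W₀ - 1‖ := by linarith
    have h1 := hA.norm_sub_sub_fderiv_le hUball hV4
    have hden : (7 / 24 : ℝ) ≤ 1 / 3 - ‖W₀ - 1‖ := by linarith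
    have hpos : (0 : ℝ) < (1 / 3 - ‖W₀ - 1‖) ^ 2 := by positivity
    refine h1.trans ?_
    rw [div_le_iff₀ hpos]
    have hsq : (7 / 24 : ℝ) ^ 2 ≤ (1 / 3 - ‖W₀ - 1‖) ^ 2 := pow_le_pow_left₀ (by norm_num) hden 2
    have hV2 : ‖V‖ ^ 2 ≤ (2 * m) ^ 2 := pow_le_pow_left₀ (norm_nonneg _) hVsup 2
    nlinarith [sq_nonneg m, mul_le_mul_of_nonneg_left hsq (sq_nonneg m)]
  have hE₂ : ‖fderiv ℂ (eml : (Idx P → Matrix n n ℂ) → Matrix n n ℂ) W₀ V - D‖ ≤ 12 * m ^ 2 := by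
    rw [hD, ← map_sub]
    exact (norm_fderiv_eml_apply_le hW₀sup6 _).trans (by linarith)
  have hHD : ‖H - D‖ ≤ 202 * m ^ 2 := by
    have e : H - D = (eml (W₀ + V) - eml W₀ - fderiv ℂ (eml : (Idx P → Matrix n n ℂ) → Matrix n n ℂ) W₀ V)
        + (fderiv ℂ (eml : (Idx P → Matrix n n ℂ) → Matrix n n ℂ) W₀ V - D) := by rw [hH, hκeml, hκ₀eml]; abel
    rw [e]; exact (norm_add_le _ _).trans (by linarith)
  have hHn : ‖H‖ ≤ 24 * m := by
    rw [hH, hκeml, hκ₀eml]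
    exact (norm_eml_add_sub_eml_le hW₀sup6 hVsup').trans (by linarith)
  -- the background correction factor is unitary
  have hκ₀u : κ₀ * star κ₀ = 1 := coe_mul_star_self _
  have hκ₀sn : ‖star κ₀‖ = 1 := by rw [norm_star]; exact norm_coe_eq_one _
  have hκ₀n : ‖κ₀‖ = 1 := norm_coe_eq_one _
  -- the straight factors
  set S : Matrix n n ℂ := ((axialAvg U c : Matrix.specialUnitaryGroup n ℂ) : Matrix n n ℂ) with hS
  set S₀ : Matrix n n ℂ := ((axialAvg U₀ c : Matrix.specialUnitaryGroup n ℂ) : Matrix n n ℂ) with hS₀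
  set ΛS : Matrix n n ℂ := covWalkSum U₀ Y (walk (emb c.src) (List.replicate P.L (c.dir, true))) with hΛS
  set G : Matrix n n ℂ := S * star S₀ - 1 with hG
  have hGb : ‖G‖ ≤ 2 * m ∧ ‖G - ΛS‖ ≤ 2 * m ^ 2 := by
    have hs1 : ((walk (emb c.src) (List.replicate P.L (c.dir, true))).map fun s => ‖pertVar U₀ U s.bond‖).sum ≤ 1 := hmS.trans hm1
    have h := norm_holRatio_bounds_perStep U₀ U (walk (emb c.src) (List.replicate P.L (c.dir, true)))
    have h2 := norm_holRatio_sub_covWalkSum_le_two_mul_sq U₀ U (walk (emb c.src) (List.replicate P.L (c.dir, true))) hs1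
    have h3 := list_prod_one_add_sub_one_le_two_mul (fun s : LStep P j => ‖pertVar U₀ U s.bond‖) (fun _ => norm_nonneg _) _ hs1
    have hm0' : 0 ≤ ((walk (emb c.src) (List.replicate P.L (c.dir, true))).map fun s => ‖pertVar U₀ U s.bond‖).sum :=
      List.sum_nonneg fun y hy => by obtain ⟨z, _, rfl⟩ := List.mem_map.mp hy; exact norm_nonneg _
    have hsq := pow_le_pow_left₀ hm0' hmS 2
    rw [hG, hS, hS₀, hΛS, axialAvg_eq_holAt_walk, axialAvg_eq_holAt_walk]
    exact ⟨h.1.trans (h3.trans (by linarith)), h2.trans (by linarith)⟩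
  -- the averaged configurations
  have hU' : ((avgFun (expMeanLogSU (n := n)) U c : Matrix.specialUnitaryGroup n ℂ) : Matrix n n ℂ) = κ * S := by
    rw [hκ, hS, ← Submonoid.coe_mul]; rfl
  have hU₀' : ((avgFun (expMeanLogSU (n := n)) U₀ c : Matrix.specialUnitaryGroup n ℂ) : Matrix n n ℂ) = κ₀ * S₀ := by
    rw [hκ₀, hS₀, ← Submonoid.coe_mul]; rfl
  -- the algebra: `κS(κ₀S₀)* − 1 − (Dκ₀* + κ₀Λ_Sκ₀*) = (H − D)κ₀* + H G κ₀* + κ₀(G − Λ_S)κ₀*`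
  have e : κ * S * star (κ₀ * S₀) - 1 - (D * star κ₀ + κ₀ * ΛS * star κ₀) =
      (H - D) * star κ₀ + H * G * star κ₀ + κ₀ * (G - ΛS) * star κ₀ := by
    rw [star_mul, hH, hG]
    have e1 : κ * S * (star S₀ * star κ₀) = κ * (S * star S₀ - 1) * star κ₀ + (κ - κ₀) * star κ₀ + κ₀ * star κ₀ := by noncomm_ring
    rw [e1, hκ₀u]
    noncomm_ring
  rw [hU', hU₀']
  show ‖κ * S * star (κ₀ * S₀) - 1 - (D * star κ₀ + κ₀ * ΛS * star κ₀)‖ ≤ 260 * m ^ 2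
  rw [e]
  calc ‖(H - D) * star κ₀ + H * G * star κ₀ + κ₀ * (G - ΛS) * star κ₀‖
      ≤ ‖H - D‖ * ‖star κ₀‖ + ‖H‖ * ‖G‖ * ‖star κ₀‖ + ‖κ₀‖ * ‖G - ΛS‖ * ‖star κ₀‖ := by
        refine (norm_add_le _ _).trans (add_le_add ((norm_add_le _ _).trans (add_le_add (norm_mul_le _ _) ?_)) ?_)
        · exact (norm_mul_le _ _).trans (mul_le_mul_of_nonneg_right (norm_mul_le _ _) (norm_nonneg _))
        · exact (norm_mul_le _ _).trans (mul_le_mul_of_nonneg_right (norm_mul_le _ _) (norm_nonneg _))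
    _ ≤ 202 * m ^ 2 * 1 + 24 * m * (2 * m) * 1 + 1 * (2 * m ^ 2) * 1 := by
        rw [hκ₀sn, hκ₀n]
        have h24 : 0 ≤ 24 * m := by positivity
        nlinarith [hHD, hHn, hGb.1, hGb.2, norm_nonneg (H - D), norm_nonneg H, norm_nonneg G, norm_nonneg (G - ΛS),
          mul_le_mul hHn hGb.1 (norm_nonneg _) h24]
    _ ≤ 260 * m ^ 2 := by nlinarith [sq_nonneg m]

end Summit.QuantumFields.YangMills.Theorems.Prop7HolRatioPerStep

end
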